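import Mathlib
import Summits.NavierStokesRegularity.NavierStokesRegularity.Theorems.EulerZoomLiouvillePowerGaugeEulerLiouvilleFrozenVorticityMember
import HarnessLib

/-!
# Crux `EulerZoomLiouville.PowerGaugeEulerLiouville` (stmt-NavierStokesRegularity-19832), stub `stub_nonSelfSimilarRest`:
# NO GENERALISED-BELTRAMI PAST — weak members whose Lamb vector is weakly a gradient on a past slab are trivial

Helper file (theorems only; `--supports stmt-NavierStokesRegularity-19832`; def-free).  Hand leafhand-ns-eulerzoomliouville-10 g3; the NON-self-similar,
regularity-free twin of hand g1's `Birth.selfSimilarWeak_of_lambFree` / `Birth.selfSimilarC2Needle_of_beltrami`, obtained from the frozen-vorticity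
kill (`Loc.ae_eq_zero_of_frozenCurl`, `…FrozenVorticityMember`).

PRINCIPLE.  Test the distributional Euler momentum equation with `θ(t) η(x)`, `η = (∂ₐg)c − (∂_c g)a` a divergence-free curl pair
(`AntiMember.momentum_tensor`): `∫∫ θ'(t)⟪u, η⟫ + θ(t)⟪u, Dη[u]⟫ = 0`.  The quadratic term is the velocity-tested weak Lamb curl
`∫⟪u, Dη[u]⟫ = −⟨ω × u, η⟩` (formally; `div η = 0` kills the Bernoulli gradient).  If it vanishes on the past slab — the Lamb vector `ω × u` is
weakly a GRADIENT there: GENERALISED BELTRAMI (Beltrami `ω × u = 0`, potential, …) in the weak sense of hand g1's `hLamb` — then the weak vorticity is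
frozen, `∫∫ θ'(t)⟪u, η⟫ = 0`, and the member is trivial.

* `Loc.ae_eq_zero_of_weakLambCurlFreePast` — MEMBER LEVEL, every `ρ > 0`, no regularity, no ansatz: crux hypotheses +
  `∫∫ θ(t)⟪u(t,x), Dη(x)[u(t,x)]⟫ = 0` for all `θ ∈ C_c^∞((−∞,T₁))` and all curl pairs `η` ⇒ `u = 0` a.e.;
* `Loc.ae_eq_zero_of_aeSliceLambCurlFree` — the same from the SLICE form: for a.e. `t < T₁`, `∫⟪u(t), Dη[u(t)]⟫ dx = 0` for all curl pairs;
* `Birth.nonSelfSimilar_of_weakLambCurlFreePast` — binder language.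

WHAT THIS IS NOT: not a proof of the stub or of the crux (the generic member has a rotational Lamb vector); nothing about Navier–Stokes.
[folklore; MajdaBertozziCUP2002 §2.4 (Beltrami flows)]
-/

noncomputable section

-- flat `Theorems/<Route><Decl>…` files of one crux share the namespace of the crux (tree convention)
set_option linter.dupNamespace false

open MeasureTheory Set Filter Topology Metric Function TopologicalSpace
open scoped RealInnerProductSpace NNReal ENNReal ContDiff

namespace Summit.NavierStokesRegularity.NavierStokesRegularity.Theorems.PowerGaugeEulerLiouville

open Literature.Analysis Literature.Analysis.FunctionSpaces Literature.Analysis.FluidPDE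

/-- **WEAK GENERALISED-BELTRAMI PAST ⇒ TRIVIAL** (member level, every `ρ > 0`, no regularity, no ansatz).  Crux hypotheses verbatim, `T₁ ≤ 0`, and the
velocity-tested weak Lamb curl vanishes on the past slab in space–time form:
`∫∫ θ(t) ⟪u(t,x), D[(∂ₐg)c − (∂_c g)a](x)[u(t,x)]⟫ = 0` for all `θ ∈ C_c^∞((−∞,T₁))`, scalar test functions `g`, vectors `a, c`.  Then `u = 0` a.e.
on the slab. [folklore] -/
theorem Loc.ae_eq_zero_of_weakLambCurlFreePast {ρ : ℝ} (hρ : 0 < ρ)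
    {u : ℝ → EuclideanSpace ℝ (Fin 3) → EuclideanSpace ℝ (Fin 3)} {p : ℝ → EuclideanSpace ℝ (Fin 3) → ℝ}
    {H : ℝ → EuclideanSpace ℝ (Fin 3) → EuclideanSpace ℝ (Fin 3) →L[ℝ] EuclideanSpace ℝ (Fin 3)} {c : ℝ≥0}
    (hsw : IsSuitableWeakSolutionOn (slab (EuclideanSpace ℝ (Fin 3)) (Iio 0) isOpen_Iio) 0 0 u p)
    (hH : HasWeakSpatialGradientOn (slab (EuclideanSpace ℝ (Fin 3)) (Iio 0) isOpen_Iio) u H)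
    (hgauge : ∀ a : ℝ, 0 < a →
      ENNReal.ofReal (a ^ (2 * ρ)) * cknA a (0 : ℝ × EuclideanSpace ℝ (Fin 3)) u +
          ENNReal.ofReal (a ^ ρ) * cknE a (0 : ℝ × EuclideanSpace ℝ (Fin 3)) H +
        ENNReal.ofReal (a ^ (2 * ρ)) * cknD a (0 : ℝ × EuclideanSpace ℝ (Fin 3)) p ≤ (c : ℝ≥0∞))
    {T₁ : ℝ} (hT₁ : T₁ ≤ 0)
    (hLamb : ∀ θ : ℝ → ℝ, ContDiff ℝ ∞ θ → HasCompactSupport θ → tsupport θ ⊆ Iio T₁ →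
      ∀ g : EuclideanSpace ℝ (Fin 3) → ℝ, IsTestFunctionOn (⊤ : Opens (EuclideanSpace ℝ (Fin 3))) g →
        ∀ a c : EuclideanSpace ℝ (Fin 3),
          ∫ z : ℝ × EuclideanSpace ℝ (Fin 3), θ z.1 *
            ⟪u z.1 z.2, fderiv ℝ (fun x => fderiv ℝ g x a • c - fderiv ℝ g x c • a) z.2 (u z.1 z.2)⟫ = 0) :
    uncurry u =ᵐ[volume.restrict (Iio (0 : ℝ) ×ˢ (univ : Set (EuclideanSpace ℝ (Fin 3))))] 0 := by
  refine Loc.ae_eq_zero_of_frozenCurl hρ hsw hH hgauge hT₁ fun θ hθ hθc hθT g hg a c' => ?_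
  have hdist := hsw.distributional
  have hθT0 : tsupport θ ⊆ Iio 0 := hθT.trans (Iio_subset_Iio hT₁)
  have hη := isTestFunctionOn_curlPair hg a c'
  have hdiv := isDivFree_curlPair_of_contDiff (hg.contDiff.of_le (by norm_cast)) a c'
  have H1 := AntiMember.momentum_tensor hdist hθ hθc hθT0 hη hdiv
  -- split the two integrable summands
  obtain ⟨hκ, hκc, hκT⟩ := AntiMember.deriv_cutoff_props hθ hθc hθT0
  have hu : LocallyIntegrableOn (uncurry u) (Iio 0 ×ˢ (univ : Set (EuclideanSpace ℝ (Fin 3)))) volume := by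
    simpa only [coe_slab] using hdist.1
  have hum : AEStronglyMeasurable (uncurry u) (volume.restrict (Iio (0 : ℝ) ×ˢ (univ : Set (EuclideanSpace ℝ (Fin 3))))) :=
    hu.aestronglyMeasurable
  have hu2 : LocallyIntegrableOn (fun z => ‖uncurry u z‖ ^ 2) (Iio (0 : ℝ) ×ˢ (univ : Set (EuclideanSpace ℝ (Fin 3)))) volume := by
    simpa only [coe_slab] using hdist.2.1
  have iA := AntiMember.integrable_mul_inner_field hu hκ hκc hκT hη.contDiff.continuous hη.hasCompactSupport
  have iB := AntiMember.integrable_mul_inner_fderiv_apply hum hu2 hθ.continuous hθc hθT0 (hη.contDiff.of_le (by norm_cast))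
    hη.hasCompactSupport
  rw [integral_add iA iB, hLamb θ hθ hθc hθT g hg a c', add_zero] at H1
  exact H1

/-- **THE SLICE FORM.**  If for a.e. `t < T₁` the slice `u(t)` has vanishing velocity-tested weak Lamb curl,
`∫ ⟪u(t,x), D[(∂ₐg)c − (∂_c g)a](x)[u(t,x)]⟫ dx = 0` for all scalar tests `g` and all `a, c` (every slice is a weak generalised-Beltrami field: its Lamb
vector is weakly a gradient), the member is trivial (Fubini to the space–time form). [folklore] -/
theorem Loc.ae_eq_zero_of_aeSliceLambCurlFree {ρ : ℝ} (hρ : 0 < ρ)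
    {u : ℝ → EuclideanSpace ℝ (Fin 3) → EuclideanSpace ℝ (Fin 3)} {p : ℝ → EuclideanSpace ℝ (Fin 3) → ℝ}
    {H : ℝ → EuclideanSpace ℝ (Fin 3) → EuclideanSpace ℝ (Fin 3) →L[ℝ] EuclideanSpace ℝ (Fin 3)} {c : ℝ≥0}
    (hsw : IsSuitableWeakSolutionOn (slab (EuclideanSpace ℝ (Fin 3)) (Iio 0) isOpen_Iio) 0 0 u p)
    (hH : HasWeakSpatialGradientOn (slab (EuclideanSpace ℝ (Fin 3)) (Iio 0) isOpen_Iio) u H)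
    (hgauge : ∀ a : ℝ, 0 < a →
      ENNReal.ofReal (a ^ (2 * ρ)) * cknA a (0 : ℝ × EuclideanSpace ℝ (Fin 3)) u +
          ENNReal.ofReal (a ^ ρ) * cknE a (0 : ℝ × EuclideanSpace ℝ (Fin 3)) H +
        ENNReal.ofReal (a ^ (2 * ρ)) * cknD a (0 : ℝ × EuclideanSpace ℝ (Fin 3)) p ≤ (c : ℝ≥0∞))
    {T₁ : ℝ} (hT₁ : T₁ ≤ 0)
    (hLamb : ∀ᵐ t ∂(volume.restrict (Iio T₁)),
      ∀ g : EuclideanSpace ℝ (Fin 3) → ℝ, IsTestFunctionOn (⊤ : Opens (EuclideanSpace ℝ (Fin 3))) g →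
        ∀ a c : EuclideanSpace ℝ (Fin 3),
          ∫ x, ⟪u t x, fderiv ℝ (fun x => fderiv ℝ g x a • c - fderiv ℝ g x c • a) x (u t x)⟫ = 0) :
    uncurry u =ᵐ[volume.restrict (Iio (0 : ℝ) ×ˢ (univ : Set (EuclideanSpace ℝ (Fin 3))))] 0 := by
  refine Loc.ae_eq_zero_of_weakLambCurlFreePast hρ hsw hH hgauge hT₁ fun θ hθ hθc hθT g hg a c' => ?_
  have hdist := hsw.distributional
  have hθT0 : tsupport θ ⊆ Iio 0 := hθT.trans (Iio_subset_Iio hT₁)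
  have hη := isTestFunctionOn_curlPair hg a c'
  have hu : LocallyIntegrableOn (uncurry u) (Iio 0 ×ˢ (univ : Set (EuclideanSpace ℝ (Fin 3)))) volume := by
    simpa only [coe_slab] using hdist.1
  have hum : AEStronglyMeasurable (uncurry u) (volume.restrict (Iio (0 : ℝ) ×ˢ (univ : Set (EuclideanSpace ℝ (Fin 3))))) :=
    hu.aestronglyMeasurable
  have hu2 : LocallyIntegrableOn (fun z => ‖uncurry u z‖ ^ 2) (Iio (0 : ℝ) ×ˢ (univ : Set (EuclideanSpace ℝ (Fin 3)))) volume := by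
    simpa only [coe_slab] using hdist.2.1
  have iB := AntiMember.integrable_mul_inner_fderiv_apply hum hu2 hθ.continuous hθc hθT0 (hη.contDiff.of_le (by norm_cast))
    hη.hasCompactSupport
  rw [Measure.volume_eq_prod] at iB
  rw [Measure.volume_eq_prod, integral_prod _ iB]
  -- the inner integral vanishes for a.e. `t`: off `(−∞,T₁)` because `θ = 0`, on it by hypothesis
  have hae : ∀ᵐ t ∂(volume : Measure ℝ),
      ∫ x, θ t * ⟪u t x, fderiv ℝ (fun x => fderiv ℝ g x a • c' - fderiv ℝ g x c' • a) x (u t x)⟫ = 0 := by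
    have h1 := ae_imp_of_ae_restrict hLamb
    filter_upwards [h1] with t ht
    by_cases htT : t < T₁
    · rw [integral_const_mul, ht htT g hg a c', mul_zero]
    · rw [AntiMember.eq_zero_of_tsupport_subset_Iio hθT (not_lt.1 htT)]
      simp
  simp only at hae ⊢
  rw [integral_congr_ae hae, integral_zero]

/-- **Binder language: NO WEAK GENERALISED-BELTRAMI PAST.**  A class member whose slices `u(t)`, for a.e. `t < T₁` (`T₁ ≤ 0`), have vanishing
velocity-tested weak Lamb curl against all curl pairs — weak Beltrami / generalised-Beltrami / potential slices — is trivial; a closed sub-stratum of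
`stub_nonSelfSimilarRest`, the non-self-similar twin of `Birth.selfSimilarWeak_of_lambFree`. [folklore] -/
theorem Birth.nonSelfSimilar_of_weakLambCurlFreePast :
    ∀ ρ : ℝ, 0 < ρ →
      ∀ (u : ℝ → EuclideanSpace ℝ (Fin 3) → EuclideanSpace ℝ (Fin 3)) (p : ℝ → EuclideanSpace ℝ (Fin 3) → ℝ)
        (H : ℝ → EuclideanSpace ℝ (Fin 3) → EuclideanSpace ℝ (Fin 3) →L[ℝ] EuclideanSpace ℝ (Fin 3)) (c : ℝ≥0),
        Birth.InClass ρ u p H c →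
          (∃ T₁ : ℝ, T₁ ≤ 0 ∧ ∀ᵐ t ∂(volume.restrict (Iio T₁)),
              ∀ g : EuclideanSpace ℝ (Fin 3) → ℝ, IsTestFunctionOn (⊤ : Opens (EuclideanSpace ℝ (Fin 3))) g →
                ∀ a c : EuclideanSpace ℝ (Fin 3),
                  ∫ x, ⟪u t x, fderiv ℝ (fun x => fderiv ℝ g x a • c - fderiv ℝ g x c • a) x (u t x)⟫ = 0) →
          uncurry u =ᵐ[volume.restrict (Iio (0 : ℝ) ×ˢ (univ : Set (EuclideanSpace ℝ (Fin 3))))] 0 := by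
  intro ρ hρ u p H c hcl h
  obtain ⟨T₁, hT₁, hLamb⟩ := h
  exact Loc.ae_eq_zero_of_aeSliceLambCurlFree hρ hcl.1 hcl.2.1 hcl.2.2 hT₁ hLamb

end Summit.NavierStokesRegularity.NavierStokesRegularity.Theorems.PowerGaugeEulerLiouville

end
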